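import Mathlib.Order.Zorn
import Literature.Computability.AlgebraicComplexity.StrassenPreorderClosure
import HarnessLib

/-!
# Maximal Strassen preorders are total (Zuiddam 2018, §2.5; Strassen 1988, §2) — proved

Topic `Literature/Computability/AlgebraicComplexity`; third file of the abstract theory of asymptotic
spectra (see `StrassenPreorder.lean`). Everything here is proved.

## Content

* `IsStrassenPreorder.exists_extension` — the **extension lemma** (Zuiddam Lemma 2.5, in a
  closure-free form): if `¬ (m + 1 + s a₂ ≼ m + s a₁)` for all `s ∈ S`, `m ∈ ℕ`, then
  `x ≼' y :⟺ ∃ s, x + s a₂ ≼ y + s a₁` is a Strassen preorder containing `≼` with `a₁ ≼' a₂`.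
  (Zuiddam assumes instead that `≼` is asymptotically closed and `a₂ ⋠ a₁`, and derives the displayed
  hypothesis from the cancellation laws 2.4(i),(ii); the construction and the verification are his.)
* `IsStrassenPreorder.exists_maximal` — Zorn: every Strassen preorder is contained in a maximal one
  (Zuiddam §2.5, the paragraph before Lemma 2.6); `asympLe_le_of_maximal` — Lemma 2.6: a maximal
  Strassen preorder is asymptotically closed.
* `IsStrassenPreorder.total_of_maximal` — **Zuiddam Lemma 2.7**: a maximal Strassen preorder is total.
  Closure-free proof: if `a ⋠ b` and `b ⋠ a` then by maximality both extension hypotheses fail,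
  `m + 1 + s b ≼ m + s a` and `m' + 1 + t a ≼ m' + t b`; multiplying by `t`, `s` and adding gives
  `(t + s) + u ≼ u`, hence `k (t + s) + u ≼ u` for all `k`, and with `1 ≼ r' s`, `u ≼ r₀` this yields
  `k ≼ r' r₀` for every `k`, contradicting axiom (1).
* `IsStrassenPreorder.exists_maximal_total` — the combination used downstream.

## References

* J. Zuiddam, PhD thesis (2018), §2.5: Lemma 2.5, Lemma 2.6, Lemma 2.7. [Zuiddam2018]
* V. Strassen, J. reine angew. Math. 384 (1988), §2. [Strassen1988]

## Mathlib

`zorn_le_nonempty₀` on the complete lattice `S → S → Prop`, `IsChain.total`.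
-/

noncomputable section

namespace Literature.Computability.AlgebraicComplexity

universe u

variable {S : Type u} [CommSemiring S]

namespace IsStrassenPreorder

variable {le : S → S → Prop}

/-- **Extension lemma** (Zuiddam Lemma 2.5, closure-free form): if no relation
`m + 1 + s a₂ ≼ m + s a₁` holds, then `≼` extends to a Strassen preorder `≼'` with `a₁ ≼' a₂`, namely
`x ≼' y :⟺ ∃ s, x + s a₂ ≼ y + s a₁`. [cite: Zuiddam2018, Lemma 2.5] -/
theorem exists_extension (h : IsStrassenPreorder le) {a₁ a₂ : S}
    (H : ∀ (s : S) (m : ℕ), ¬ le ((m : S) + 1 + s * a₂) ((m : S) + s * a₁)) :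
    ∃ le' : S → S → Prop, IsStrassenPreorder le' ∧ (∀ x y, le x y → le' x y) ∧ le' a₁ a₂ := by
  refine ⟨fun x y => ∃ s : S, le (x + s * a₂) (y + s * a₁), ?_, ?_, ?_⟩
  · exact
      { refl := fun a => ⟨0, by simpa using h.refl a⟩
        trans := by
          rintro a b c ⟨s, hs⟩ ⟨t, ht⟩
          refine ⟨t + s, ?_⟩
          have s1 := h.add_right (t * a₂) hs
          have s2 := h.add_right (s * a₁) ht
          have e1 : a + (t + s) * a₂ = a + s * a₂ + t * a₂ := by ring
          have e2 : b + s * a₁ + t * a₂ = b + t * a₂ + s * a₁ := by ring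
          have e3 : c + (t + s) * a₁ = c + t * a₁ + s * a₁ := by ring
          rw [e1, e3]
          rw [e2] at s1
          exact h.trans s1 s2
        natCast_le_iff := by
          intro n m
          constructor
          · rintro ⟨s, hs⟩
            by_contra hnm
            have hmn : le (((m + 1 : ℕ) : S)) (n : S) := (h.natCast_le_iff _ _).2 (by omega)
            have s1 := h.add_right (s * a₂) hmn
            have s2 := h.trans s1 hs
            exact H s m (by simpa using s2)
          · intro hnm
            exact ⟨0, by simpa using (h.natCast_le_iff n m).2 hnm⟩
        add_right := by
          rintro a b c ⟨s, hs⟩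
          refine ⟨s, ?_⟩
          have s1 := h.add_right c hs
          have e1 : a + c + s * a₂ = a + s * a₂ + c := by ring
          have e2 : b + c + s * a₁ = b + s * a₁ + c := by ring
          rw [e1, e2]
          exact s1
        mul_right := by
          rintro a b c ⟨s, hs⟩
          refine ⟨s * c, ?_⟩
          have s1 := h.mul_right c hs
          have e1 : a * c + s * c * a₂ = (a + s * a₂) * c := by ring
          have e2 : b * c + s * c * a₁ = (b + s * a₁) * c := by ring
          rw [e1, e2]
          exact s1
        exists_le_natCast_mul := by
          intro a b hb
          obtain ⟨r, hr⟩ := h.exists_le_natCast_mul a hb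
          exact ⟨r, 0, by simpa using hr⟩ }
  · intro x y hxy
    exact ⟨0, by simpa using hxy⟩
  · refine ⟨1, ?_⟩
    rw [one_mul, one_mul, add_comm a₂ a₁]
    exact h.refl _

/-- **Zorn** (Zuiddam §2.5): every Strassen preorder is contained in a maximal Strassen preorder
(the union of a chain of Strassen preorders is a Strassen preorder). [cite: Zuiddam2018, §2.5] -/
theorem exists_maximal (h : IsStrassenPreorder le) :
    ∃ le' : S → S → Prop, IsStrassenPreorder le' ∧ (∀ x y, le x y → le' x y) ∧
      ∀ le'' : S → S → Prop, IsStrassenPreorder le'' → (∀ x y, le' x y → le'' x y) →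
        ∀ x y, le'' x y → le' x y := by
  have hchain : ∀ c ⊆ {R : S → S → Prop | IsStrassenPreorder R}, IsChain (· ≤ ·) c →
      ∀ y ∈ c, ∃ ub ∈ {R : S → S → Prop | IsStrassenPreorder R}, ∀ z ∈ c, z ≤ ub := by
    intro c hc hch R₀ hR₀
    have h₀ : IsStrassenPreorder R₀ := hc hR₀
    refine ⟨fun x y => ∃ R ∈ c, R x y, ?_, fun z hz x y hxy => ⟨z, hz, hxy⟩⟩
    exact
      { refl := fun a => ⟨R₀, hR₀, h₀.refl a⟩
        trans := by
          rintro x y z ⟨R₁, hR₁, h₁⟩ ⟨R₂, hR₂, h₂⟩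
          rcases hch.total hR₁ hR₂ with h12 | h21
          · exact ⟨R₂, hR₂, (hc hR₂).trans (h12 x y h₁) h₂⟩
          · exact ⟨R₁, hR₁, (hc hR₁).trans h₁ (h21 y z h₂)⟩
        natCast_le_iff := fun n m =>
          ⟨fun ⟨R, hR, hnm⟩ => ((hc hR).natCast_le_iff n m).1 hnm,
            fun hnm => ⟨R₀, hR₀, (h₀.natCast_le_iff n m).2 hnm⟩⟩
        add_right := by
          rintro x y w ⟨R, hR, hxy⟩
          exact ⟨R, hR, (hc hR).add_right w hxy⟩
        mul_right := by
          rintro x y w ⟨R, hR, hxy⟩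
          exact ⟨R, hR, (hc hR).mul_right w hxy⟩
        exists_le_natCast_mul := by
          intro a b hb
          obtain ⟨r, hr⟩ := h₀.exists_le_natCast_mul a hb
          exact ⟨r, R₀, hR₀, hr⟩ }
  obtain ⟨m, hlem, hmax⟩ := zorn_le_nonempty₀ {R : S → S → Prop | IsStrassenPreorder R} hchain le h
  refine ⟨m, hmax.prop, fun x y hxy => hlem x y hxy, fun le'' h'' hle'' => ?_⟩
  exact hmax.le_of_ge h'' hle''

/-- **Zuiddam Lemma 2.6**: a maximal Strassen preorder is asymptotically closed, `≼~ ⊆ ≼`. [cite: Zuiddam2018, Lemma 2.6] -/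
theorem asympLe_le_of_maximal (h : IsStrassenPreorder le)
    (hmax : ∀ le'' : S → S → Prop, IsStrassenPreorder le'' → (∀ x y, le x y → le'' x y) →
      ∀ x y, le'' x y → le x y) (x y : S) (hxy : AsympLe le x y) : le x y :=
  hmax _ h.asympLe (fun _ _ => h.asympLe_of_le) x y hxy

/-- **Zuiddam Lemma 2.7**: a maximal Strassen preorder is total. (Closure-free proof, see the module
docstring.) [cite: Zuiddam2018, Lemma 2.7] -/
theorem total_of_maximal (h : IsStrassenPreorder le)
    (hmax : ∀ le'' : S → S → Prop, IsStrassenPreorder le'' → (∀ x y, le x y → le'' x y) →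
      ∀ x y, le'' x y → le x y) (a b : S) : le a b ∨ le b a := by
  by_contra hab
  rw [not_or] at hab
  -- by maximality, both extension hypotheses fail
  have key : ∀ a₁ a₂ : S, ¬ le a₁ a₂ →
      ∃ (s : S) (m : ℕ), le ((m : S) + 1 + s * a₂) ((m : S) + s * a₁) := by
    intro a₁ a₂ hna
    by_contra hH
    simp only [not_exists] at hH
    obtain ⟨le', h', hle', h12⟩ := h.exists_extension hH
    exact hna (hmax le' h' hle' _ _ h12)
  obtain ⟨s, m, hs⟩ := key a b hab.1
  obtain ⟨t, m', ht⟩ := key b a hab.2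
  have s3 := h.add_le_add (h.mul_left t hs) (h.mul_left s ht)
  set u : S := t * (m : S) + s * (m' : S) + s * t * (a + b) with hu
  have e1 : t * ((m : S) + 1 + s * b) + s * ((m' : S) + 1 + t * a) = (t + s) + u := by
    rw [hu]; ring
  have e2 : t * ((m : S) + s * a) + s * ((m' : S) + t * b) = u := by
    rw [hu]; ring
  rw [e1, e2] at s3
  -- iterate: `k (t + s) + u ≼ u`
  have iter : ∀ k : ℕ, le ((k : S) * (t + s) + u) u := by
    intro k
    induction k with
    | zero => simpa using h.refl u
    | succ k ih =>
      have s4 := h.add_left (t + s) ih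
      have e : ((k + 1 : ℕ) : S) * (t + s) + u = (t + s) + ((k : S) * (t + s) + u) := by
        push_cast; ring
      rw [e]
      exact h.trans s4 s3
  -- `s ≠ 0`
  have hs0 : s ≠ 0 := by
    rintro rfl
    simp only [zero_mul, add_zero] at hs
    have := (h.natCast_le_iff (m + 1) m).1 (by push_cast; exact hs)
    omega
  obtain ⟨r', hr'⟩ := h.exists_one_le_natCast_mul hs0
  obtain ⟨r₀, hr₀⟩ := h.exists_le_natCast u
  refine h.not_forall_natCast_le ((r' : S) * (r₀ : S)) fun k => ?_
  have c1 : le ((k : S) * 1) ((k : S) * ((r' : S) * s)) := h.mul_left _ hr'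
  have c2 : le ((r' : S) * ((k : S) * s)) ((r' : S) * ((k : S) * (t + s))) :=
    h.mul_left _ (h.mul_left _ (h.le_add_left s t))
  have c3 : le ((r' : S) * ((k : S) * (t + s))) ((r' : S) * ((k : S) * (t + s) + u)) :=
    h.mul_left _ (h.le_add_right _ _)
  have c4 : le ((r' : S) * ((k : S) * (t + s) + u)) ((r' : S) * u) := h.mul_left _ (iter k)
  have c5 : le ((r' : S) * u) ((r' : S) * (r₀ : S)) := h.mul_left _ hr₀
  have e3 : (k : S) * ((r' : S) * s) = (r' : S) * ((k : S) * s) := by ring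
  rw [mul_one, e3] at c1
  exact h.trans c1 (h.trans c2 (h.trans c3 (h.trans c4 c5)))

/-- Every Strassen preorder is contained in a maximal, hence total and asymptotically closed,
Strassen preorder (Zuiddam §2.5). [cite: Zuiddam2018, Lemma 2.7] -/
theorem exists_maximal_total (h : IsStrassenPreorder le) :
    ∃ le' : S → S → Prop, IsStrassenPreorder le' ∧ (∀ x y, le x y → le' x y) ∧
      (∀ a b, le' a b ∨ le' b a) ∧ (∀ x y, AsympLe le' x y → le' x y) := by
  obtain ⟨le', h', hle', hmax⟩ := h.exists_maximal
  exact ⟨le', h', hle', h'.total_of_maximal hmax, h'.asympLe_le_of_maximal hmax⟩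

end IsStrassenPreorder

end Literature.Computability.AlgebraicComplexity

end
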